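import Literature.InformationTheory.QuantumCodes.QuantumExpanderCodeParameters
import HarnessLib

/-!
# Quantum expander codes: critical generators (Leverrier–Tillich–Zémor 2015 Def. 6 =
# Fawzi–Grospellier–Leverrier 2018 Def. 22) — DEFINITIONS and their small API

Topic `Literature/InformationTheory/QuantumCodes` (venture QEC, LADDER-QEC Q3/Q4: the combinatorial core
of the small-set-flip decoder analysis). Sources: A. Leverrier, J.-P. Tillich, G. Zémor, *Quantum expander
codes*, FOCS 2015, arXiv:1504.00822v1 — Def. 6 (p0008 L60-80), Lemma 7 (p0008 L95-98), proof = App. A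
"Proof of Lemma 7" (p0012 L1-60, p0013 L1-9); O. Fawzi, A. Grospellier, A. Leverrier, *Efficient decoding
of random errors for quantum expander codes*, STOC 2018, arXiv:1711.08351v2 — Def. 22, Lemma 23 (§7.1,
p0018 L10-35).

Objects (over `QuantumExpanderCodes.lean`: `H : Matrix B A (ZMod 2)` the biadjacency matrix of
`G = (A ∪ B, ℰ)`; qubits `(A × A) ⊕ (B × B)` with `Sum.inl (α, a)` = the qubit "`αa ∈ A²`" and
`Sum.inr (b, β)` = "`bβ ∈ B²`"; the `σ_X`-check `αβ ∈ A × B` sees `αa'` iff `a' ∼ β` and `b'β` iff `b' ∼ α`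
(`expanderHX = zMatrix H Hᵀ`); the generator `g_{ba}`, `(b, a) ∈ B × A`, is
`{αa : α ∼ b} ∪ {bβ : β ∼ a}` (row `(b,a)` of `expanderHZ = xMatrix H Hᵀ`)).

* `nbrs H a` — `Γ(a) = {b : H b a ≠ 0}` (so `nbrs Hᵀ b = Γ(b) ⊆ A`); `uniqueNbrs H S a` — `Γ_u^S(a)`, the
  neighbours of `a` whose only neighbour inside `S` is `a` (LTZ15 App. A eq. (um)).
* `IsCritical H dA dB δA δB E b a Χa Χb` — **`g_{ba}` is a critical generator for the error support `E`**
  (FGL18 Def. 22 = LTZ15 Def. 6), encoded by the two "multiple-neighbour" index sets `Χa ⊆ Γ(b)`,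
  `Χb ⊆ Γ(a)` (the printed `χ_a = {αa : α ∈ Χa}`, `χ_b = {bβ : β ∈ Χb}`); the remaining parts of the
  printed partition are DETERMINED: `x_a = {αa ∈ E : α ∈ Γ(b) ∖ Χa}`, `x̄_a = {αa ∉ E : α ∈ Γ(b) ∖ Χa}`,
  `x_b`, `x̄_b` likewise. Fields: `|Χa| ≤ 2δ_B d_B`, `|Χb| ≤ 2δ_A d_A`; the four printed neighbourhood
  conditions in one "clean grid" clause — for `α ∈ Γ(b) ∖ Χa`, `β ∈ Γ(a) ∖ Χb`, every error qubit seen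
  by the check `αβ` is `αa` or `bβ` (so `E ∩ Γ[Γ(v_a) ∩ Γ(v_b)]` is `{v_a, v_b} ∩ E`, which is the four
  printed cases according to membership); and `x_a ∪ x_b ≠ ∅`.
* the projections `projA` (`E_A²`), `projB`, `projBOn` (`E¹_{B,a}`) of App. A, the flip set
  `critFlip = x_a ⊎ x_b` (index sets `critX`, `critY`) of FGL18 Lemma 24 with `critFlip_mem_smallSets`
  (it is a SMALL SET of the small-set-flip decoder), and the weighted size `wnorm` (`Δ_AΔ_B‖E‖`,
  FGL18's "reduced cardinality", kept integral).

This is the DEFINITIONS file (column word: definition + small API lemmas, all PROVED); the existence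
theorem LTZ15 Lemma 7 / FGL18 Lemma 23 is `exists_isCritical` in `QuantumExpanderCriticalGeneratorsExist.lean`;
no decoder statement is made here.
-/

namespace Literature.InformationTheory.QuantumCodes

namespace QuantumExpander

open Finset Matrix

variable {A B : Type*} [Fintype A] [Fintype B] [DecidableEq A] [DecidableEq B]

/-! ### Neighbourhoods and unique neighbours of a single vertex -/

/-- `Γ(a) = {b : H b a ≠ 0}`, the neighbourhood of the left vertex (column) `a`; for a right vertex `b`
use `nbrs Hᵀ b = {α : H b α ≠ 0}`. [cite: LeverrierTillichZemor2015, §2 (Γ; arXiv v1 p0005 L12)] -/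
def nbrs (H : Matrix B A (ZMod 2)) (a : A) : Finset B :=
  univ.filter fun b => H b a ≠ 0

/-- `Γ_u^S(a)`: the neighbours of `a` that have no other neighbour inside `S` ("the set of unique
neighbors of `a` in the subgraph of `G` induced by `S ∪ Γ(S)`", for `a ∈ S`).
[cite: LeverrierTillichZemor2015, App. A eq. (um) (arXiv v1 p0012 L8-12)] -/
def uniqueNbrs (H : Matrix B A (ZMod 2)) (S : Finset A) (a : A) : Finset B :=
  univ.filter fun b => H b a ≠ 0 ∧ ∀ a' ∈ S, H b a' ≠ 0 → a' = a

omit [Fintype A] [DecidableEq A] [DecidableEq B] in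
/-- Membership in `Γ(a)`. [cite: LeverrierTillichZemor2015, §2 (arXiv v1 p0005 L12)] -/
@[simp] theorem mem_nbrs {H : Matrix B A (ZMod 2)} {a : A} {b : B} : b ∈ nbrs H a ↔ H b a ≠ 0 := by
  simp [nbrs]

omit [DecidableEq B] in
/-- Membership in `Γ_u^S(a)`. [cite: LeverrierTillichZemor2015, App. A eq. (um) (arXiv v1 p0012 L8-12)] -/
theorem mem_uniqueNbrs {H : Matrix B A (ZMod 2)} {S : Finset A} {a : A} {b : B} :
    b ∈ uniqueNbrs H S a ↔ H b a ≠ 0 ∧ ∀ a' ∈ S, H b a' ≠ 0 → a' = a := by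
  simp [uniqueNbrs]

omit [DecidableEq B] in
/-- `Γ_u^S(a) ⊆ Γ(a)`. [cite: LeverrierTillichZemor2015, App. A eq. (um) (arXiv v1 p0012 L8-12)] -/
theorem uniqueNbrs_subset_nbrs (H : Matrix B A (ZMod 2)) (S : Finset A) (a : A) :
    uniqueNbrs H S a ⊆ nbrs H a := by
  intro b hb
  rw [mem_uniqueNbrs] at hb
  exact mem_nbrs.2 hb.1

omit [DecidableEq A] [DecidableEq B] in
/-- In a biregular graph `|Γ(a)| = d_A`. [cite: LeverrierTillichZemor2015, §2 (biregular; arXiv v1 p0005 L5-8)] -/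
theorem card_nbrs_eq (H : Matrix B A (ZMod 2)) {dA dB : ℕ} (hreg : IsBiregular H dA dB) (a : A) :
    (nbrs H a).card = dA :=
  hreg.1 a

omit [DecidableEq A] [DecidableEq B] in
/-- In a biregular graph `|Γ(b)| = d_B` (as `nbrs Hᵀ b`). [cite: LeverrierTillichZemor2015, §2 (biregular; arXiv v1 p0005 L5-8)] -/
theorem card_nbrs_transpose_eq (H : Matrix B A (ZMod 2)) {dA dB : ℕ} (hreg : IsBiregular H dA dB)
    (b : B) : (nbrs Hᵀ b).card = dB := by
  have h := hreg.2 b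
  simpa [nbrs, Matrix.transpose_apply] using h

omit [DecidableEq A] [DecidableEq B] in
/-- Biregularity of the reversed graph. [cite: LeverrierTillichZemor2015, §2 (arXiv v1 p0005 L5-8)] -/
theorem isBiregular_transpose (H : Matrix B A (ZMod 2)) {dA dB : ℕ} (hreg : IsBiregular H dA dB) :
    IsBiregular Hᵀ dB dA := by
  refine ⟨fun b => ?_, fun a => ?_⟩
  · simpa [Matrix.transpose_apply] using hreg.2 b
  · simpa [Matrix.transpose_apply] using hreg.1 a

/-! ### Critical generators -/

/-- **`g_{ba}` is a critical generator for the error support `E`** (LTZ15 Def. 6 = FGL18 Def. 22), encoded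
by the "multiple-neighbour" parts `Χa ⊆ Γ(b)` (indices of `χ_a`) and `Χb ⊆ Γ(a)` (indices of `χ_b`); the
other four parts of the printed partition `g_{ba} = x_a ∪ x̄_a ∪ χ_a ∪ x_b ∪ x̄_b ∪ χ_b` are determined by
`E` (`x_a`/`x̄_a` = the error/error-free qubits `αa`, `α ∈ Γ(b) ∖ Χa`; `x_b`/`x̄_b` likewise). Fields:
the bounds `|χ_a| ≤ 2δ_B Δ_B`, `|χ_b| ≤ 2δ_A Δ_A`; the CLEAN-GRID clause — for `α ∈ Γ(b) ∖ Χa` and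
`β ∈ Γ(a) ∖ Χb` every error qubit seen by the check `αβ` is `αa` or `bβ` (this is the conjunction of the
four printed conditions "every vertex in `Γ(x_a) ∩ Γ(x_b)` has exactly two neighbors in `E`", "… in
`Γ(x̄_a) ∩ Γ(x̄_b)` has no neighbor in `E`", "… in `Γ(x_a) ∩ Γ(x̄_b)` and … `Γ(x̄_a) ∩ Γ(x_b)` has exactly
one", read with the memberships of `αa`, `bβ`); and `x_a ∪ x_b ≠ ∅`.
[cite: LeverrierTillichZemor2015, Def. 6 (arXiv v1 p0008 L60-80)] [cite: FawziGrospellierLeverrier2018, Def 22 (§7.1, arXiv v2 p0018 L10-24)] -/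
structure IsCritical (H : Matrix B A (ZMod 2)) (dA dB : ℕ) (δA δB : ℝ)
    (E : Finset ((A × A) ⊕ (B × B))) (b : B) (a : A) (Χa : Finset A) (Χb : Finset B) : Prop where
  /-- `χ_a ⊆ g_{ba} ∩ A²`, i.e. `Χa ⊆ Γ(b)`. -/
  Χa_subset : Χa ⊆ nbrs Hᵀ b
  /-- `χ_b ⊆ g_{ba} ∩ B²`, i.e. `Χb ⊆ Γ(a)`. -/
  Χb_subset : Χb ⊆ nbrs H a
  /-- `|χ_a| ≤ 2δ_B Δ_B`. -/
  card_Χa_le : (Χa.card : ℝ) ≤ 2 * δB * dB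
  /-- `|χ_b| ≤ 2δ_A Δ_A`. -/
  card_Χb_le : (Χb.card : ℝ) ≤ 2 * δA * dA
  /-- Clean grid: off `χ_a`, `χ_b`, the check `αβ` sees no error qubit other than `αa` and `bβ`. -/
  clean : ∀ α ∈ nbrs Hᵀ b \ Χa, ∀ β ∈ nbrs H a \ Χb,
      (∀ a' : A, H β a' ≠ 0 → Sum.inl (α, a') ∈ E → a' = a) ∧
      (∀ b' : B, H b' α ≠ 0 → Sum.inr (b', β) ∈ E → b' = b)
  /-- `x_a ∪ x_b ≠ ∅`. -/
  nonempty : (∃ α ∈ nbrs Hᵀ b \ Χa, Sum.inl (α, a) ∈ E) ∨ (∃ β ∈ nbrs H a \ Χb, Sum.inr (b, β) ∈ E)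

/-! ### The projections of App. A (`E_A²`, `E¹_{B,a}`) -/

/-- The projection of the `A²`-errors on their second coordinate, `E_A² = {a : ∃ α, αa ∈ E}`.
[cite: LeverrierTillichZemor2015, App. A eq. (E_A^2) (arXiv v1 p0012 L20-23)] -/
def projA (E : Finset ((A × A) ⊕ (B × B))) : Finset A :=
  E.biUnion fun q => match q with
    | Sum.inl p => {p.2}
    | Sum.inr _ => ∅

/-- The projection of the `B²`-errors on their first coordinate, `{b : ∃ β, bβ ∈ E}` (used in the mirror
case `E_A = ∅`). [cite: LeverrierTillichZemor2015, App. A (arXiv v1 p0012 L38: "roles of A and B interchanged")] -/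
def projB (E : Finset ((A × A) ⊕ (B × B))) : Finset B :=
  E.biUnion fun q => match q with
    | Sum.inl _ => ∅
    | Sum.inr p => {p.1}

/-- The projection on the first coordinate of the `B²`-errors lying on the columns `U`:
`E¹_{B,a} = {b : ∃ β ∈ Γ_u(a), bβ ∈ E}` for `U = Γ_u(a)`.
[cite: LeverrierTillichZemor2015, App. A eq. (E^1_{B,a}) (arXiv v1 p0012 L47-50)] -/
def projBOn (E : Finset ((A × A) ⊕ (B × B))) (U : Finset B) : Finset B :=
  E.biUnion fun q => match q with
    | Sum.inl _ => ∅
    | Sum.inr p => if p.2 ∈ U then {p.1} else ∅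

omit [Fintype A] [Fintype B] [DecidableEq B] in
/-- Membership in `E_A²`. [cite: LeverrierTillichZemor2015, App. A eq. (E_A^2) (arXiv v1 p0012 L20-23)] -/
theorem mem_projA {E : Finset ((A × A) ⊕ (B × B))} {a : A} :
    a ∈ projA E ↔ ∃ α, Sum.inl (α, a) ∈ E := by
  constructor
  · intro h
    obtain ⟨q, hq, ha⟩ := Finset.mem_biUnion.1 h
    rcases q with ⟨α, a'⟩ | ⟨b, β⟩
    · simp only [Finset.mem_singleton] at ha
      subst ha
      exact ⟨α, hq⟩
    · simp at ha
  · rintro ⟨α, hα⟩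
    exact Finset.mem_biUnion.2 ⟨Sum.inl (α, a), hα, by simp⟩

omit [Fintype A] [Fintype B] [DecidableEq A] in
/-- Membership in the first-coordinate projection of the `B²`-errors.
[cite: LeverrierTillichZemor2015, App. A (arXiv v1 p0012 L38)] -/
theorem mem_projB {E : Finset ((A × A) ⊕ (B × B))} {b : B} :
    b ∈ projB E ↔ ∃ β, Sum.inr (b, β) ∈ E := by
  constructor
  · intro h
    obtain ⟨q, hq, hb⟩ := Finset.mem_biUnion.1 h
    rcases q with ⟨α, a'⟩ | ⟨b', β⟩
    · simp at hb
    · simp only [Finset.mem_singleton] at hb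
      subst hb
      exact ⟨β, hq⟩
  · rintro ⟨β, hβ⟩
    exact Finset.mem_biUnion.2 ⟨Sum.inr (b, β), hβ, by simp⟩

omit [Fintype A] [Fintype B] [DecidableEq A] in
/-- Membership in `E¹_{B,a}`. [cite: LeverrierTillichZemor2015, App. A eq. (E^1_{B,a}) (arXiv v1 p0012 L47-50)] -/
theorem mem_projBOn {E : Finset ((A × A) ⊕ (B × B))} {U : Finset B} {b : B} :
    b ∈ projBOn E U ↔ ∃ β ∈ U, Sum.inr (b, β) ∈ E := by
  constructor
  · intro h
    obtain ⟨q, hq, hb⟩ := Finset.mem_biUnion.1 h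
    rcases q with ⟨α, a'⟩ | ⟨b', β⟩
    · simp at hb
    · by_cases hβ : β ∈ U
      · simp only [hβ, if_true, Finset.mem_singleton] at hb
        subst hb
        exact ⟨β, hβ, hq⟩
      · simp [hβ] at hb
  · rintro ⟨β, hβU, hβ⟩
    exact Finset.mem_biUnion.2 ⟨Sum.inr (b, β), hβ, by simp [hβU]⟩

omit [Fintype A] [Fintype B] [DecidableEq B] in
/-- `|E_A²| ≤ |E|`. [cite: LeverrierTillichZemor2015, App. A (arXiv v1 p0012 L24: |E_A^2| ≤ |E_A| ≤ w(e))] -/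
theorem card_projA_le (E : Finset ((A × A) ⊕ (B × B))) : (projA E).card ≤ E.card := by
  unfold projA
  refine Finset.card_biUnion_le.trans ?_
  rw [Finset.card_eq_sum_ones E]
  refine Finset.sum_le_sum fun q _ => ?_
  rcases q with ⟨α, a⟩ | ⟨b, β⟩ <;> simp

omit [Fintype A] [Fintype B] [DecidableEq A] in
/-- `|projB E| ≤ |E|`. [cite: LeverrierTillichZemor2015, App. A (arXiv v1 p0012 L24, L38)] -/
theorem card_projB_le (E : Finset ((A × A) ⊕ (B × B))) : (projB E).card ≤ E.card := by
  unfold projB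
  refine Finset.card_biUnion_le.trans ?_
  rw [Finset.card_eq_sum_ones E]
  refine Finset.sum_le_sum fun q _ => ?_
  rcases q with ⟨α, a⟩ | ⟨b, β⟩ <;> simp

omit [Fintype A] [Fintype B] [DecidableEq A] in
/-- `|E¹_{B,a}| ≤ |E|`. [cite: LeverrierTillichZemor2015, App. A (arXiv v1 p0012 L44-46)] -/
theorem card_projBOn_le (E : Finset ((A × A) ⊕ (B × B))) (U : Finset B) :
    (projBOn E U).card ≤ E.card := by
  unfold projBOn
  refine Finset.card_biUnion_le.trans ?_
  rw [Finset.card_eq_sum_ones E]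
  refine Finset.sum_le_sum fun q _ => ?_
  rcases q with ⟨α, a⟩ | ⟨b, β⟩
  · simp
  · by_cases h : β ∈ U <;> simp [h]

/-! ### The flip set `x_a ∪ x_b` of a critical generator, the weighted size `‖E‖·Δ_AΔ_B` -/

/-- The index set of `x_a = {αa ∈ E : α ∈ Γ(b) ∖ Χa}` for the error vector `e` (support `E`).
[cite: FawziGrospellierLeverrier2018, Def 22 (x_a; §7.1, arXiv v2 p0018 L12-16)] -/
def critX (H : Matrix B A (ZMod 2)) (e : (A × A) ⊕ (B × B) → ZMod 2) (b : B) (a : A) (Χa : Finset A) :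
    Finset A :=
  (nbrs Hᵀ b \ Χa).filter fun α => e (Sum.inl (α, a)) ≠ 0

/-- The index set of `x_b = {bβ ∈ E : β ∈ Γ(a) ∖ Χb}`.
[cite: FawziGrospellierLeverrier2018, Def 22 (x_b; §7.1, arXiv v2 p0018 L12-16)] -/
def critY (H : Matrix B A (ZMod 2)) (e : (A × A) ⊕ (B × B) → ZMod 2) (b : B) (a : A) (Χb : Finset B) :
    Finset B :=
  (nbrs H a \ Χb).filter fun β => e (Sum.inr (b, β)) ≠ 0

/-- The flip set `F = x_a ⊎ x_b ⊆ g_{ba}` of FGL18's Lemma 24 ("if we flip `F = x_A ⊎ x_B` in the generator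
promised by the lemma"). [cite: FawziGrospellierLeverrier2018, Lemma 24 proof (§7.1, arXiv v2 p0018 L70)] -/
def critFlip (H : Matrix B A (ZMod 2)) (e : (A × A) ⊕ (B × B) → ZMod 2) (b : B) (a : A)
    (Χa : Finset A) (Χb : Finset B) : Finset ((A × A) ⊕ (B × B)) :=
  (critX H e b a Χa).image (fun α => Sum.inl (α, a)) ∪ (critY H e b a Χb).image (fun β => Sum.inr (b, β))

/-- The weighted size `Δ_A |E ∩ A²| + Δ_B |E ∩ B²| = Δ_A Δ_B ‖E‖` of (the support of) an error vector, with
FGL18's "reduced cardinality" `‖E‖ = |E ∩ A²|/d_B + |E ∩ B²|/d_A` (kept integral).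
[cite: FawziGrospellierLeverrier2018, Lemma 24 proof (‖E‖; §7.1, arXiv v2 p0018 L40-46)] -/
def wnorm (dA dB : ℕ) (e : (A × A) ⊕ (B × B) → ZMod 2) : ℕ :=
  dA * (univ.filter fun p : A × A => e (Sum.inl p) ≠ 0).card
    + dB * (univ.filter fun p : B × B => e (Sum.inr p) ≠ 0).card

omit [Fintype B] [DecidableEq B] in
/-- Membership in the `x_a`-index set. [cite: FawziGrospellierLeverrier2018, Def 22 (§7.1, arXiv v2 p0018 L12-16)] -/
theorem mem_critX {H : Matrix B A (ZMod 2)} {e : (A × A) ⊕ (B × B) → ZMod 2} {b : B} {a : A}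
    {Χa : Finset A} {α : A} :
    α ∈ critX H e b a Χa ↔ (H b α ≠ 0 ∧ α ∉ Χa) ∧ e (Sum.inl (α, a)) ≠ 0 := by
  simp [critX, nbrs, Matrix.transpose_apply]

omit [Fintype A] [DecidableEq A] in
/-- Membership in the `x_b`-index set. [cite: FawziGrospellierLeverrier2018, Def 22 (§7.1, arXiv v2 p0018 L12-16)] -/
theorem mem_critY {H : Matrix B A (ZMod 2)} {e : (A × A) ⊕ (B × B) → ZMod 2} {b : B} {a : A}
    {Χb : Finset B} {β : B} :
    β ∈ critY H e b a Χb ↔ (H β a ≠ 0 ∧ β ∉ Χb) ∧ e (Sum.inr (b, β)) ≠ 0 := by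
  simp [critY, nbrs]

/-- Membership in the flip set: `inl (α, a')` is in `F` iff `a' = a` and `α ∈ X_a`.
[cite: FawziGrospellierLeverrier2018, Lemma 24 proof (F = x_A ⊎ x_B; arXiv v2 p0018 L70)] -/
theorem inl_mem_critFlip {H : Matrix B A (ZMod 2)} {e : (A × A) ⊕ (B × B) → ZMod 2} {b : B} {a : A}
    {Χa : Finset A} {Χb : Finset B} {α a' : A} :
    Sum.inl (α, a') ∈ critFlip H e b a Χa Χb ↔ a' = a ∧ α ∈ critX H e b a Χa := by
  simp only [critFlip, Finset.mem_union, Finset.mem_image, Sum.inl.injEq, Prod.mk.injEq,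
    reduceCtorEq, and_false, exists_false, or_false]
  constructor
  · rintro ⟨α', hα', rfl, rfl⟩; exact ⟨rfl, hα'⟩
  · rintro ⟨rfl, hα⟩; exact ⟨α, hα, rfl, rfl⟩

/-- Membership in the flip set: `inr (b', β)` is in `F` iff `b' = b` and `β ∈ Y_b`.
[cite: FawziGrospellierLeverrier2018, Lemma 24 proof (F = x_A ⊎ x_B; arXiv v2 p0018 L70)] -/
theorem inr_mem_critFlip {H : Matrix B A (ZMod 2)} {e : (A × A) ⊕ (B × B) → ZMod 2} {b : B} {a : A}
    {Χa : Finset A} {Χb : Finset B} {b' : B} {β : B} :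
    Sum.inr (b', β) ∈ critFlip H e b a Χa Χb ↔ b' = b ∧ β ∈ critY H e b a Χb := by
  simp only [critFlip, Finset.mem_union, Finset.mem_image, Sum.inr.injEq, Prod.mk.injEq,
    reduceCtorEq, and_false, exists_false, false_or]
  constructor
  · rintro ⟨β', hβ', rfl, rfl⟩; exact ⟨rfl, hβ'⟩
  · rintro ⟨rfl, hβ⟩; exact ⟨β, hβ, rfl, rfl⟩

/-- `|F| = |x_a| + |x_b|`. [cite: FawziGrospellierLeverrier2018, Lemma 24 proof (‖F‖ = x + y; arXiv v2 p0018 L72-80)] -/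
theorem card_critFlip (H : Matrix B A (ZMod 2)) (e : (A × A) ⊕ (B × B) → ZMod 2) (b : B) (a : A)
    (Χa : Finset A) (Χb : Finset B) :
    (critFlip H e b a Χa Χb).card = (critX H e b a Χa).card + (critY H e b a Χb).card := by
  rw [critFlip, Finset.card_union_of_disjoint, Finset.card_image_of_injective,
    Finset.card_image_of_injective]
  · intro β β' h; simpa using h
  · intro α α' h; simpa using h
  · rw [Finset.disjoint_left]
    intro q hq hq'
    obtain ⟨α, -, rfl⟩ := Finset.mem_image.1 hq
    obtain ⟨β, -, h⟩ := Finset.mem_image.1 hq'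
    cases h

/-- `F ⊆ E`: the flipped qubits are error qubits. [cite: FawziGrospellierLeverrier2018, Def 22 (x_a, x_b ⊆ E)] -/
theorem critFlip_subset_supp (H : Matrix B A (ZMod 2)) (e : (A × A) ⊕ (B × B) → ZMod 2) (b : B) (a : A)
    (Χa : Finset A) (Χb : Finset B) : critFlip H e b a Χa Χb ⊆ supp e := by
  intro q hq
  rcases q with ⟨α, a'⟩ | ⟨b', β⟩
  · obtain ⟨rfl, hα⟩ := inl_mem_critFlip.1 hq
    simpa [supp] using (mem_critX.1 hα).2
  · obtain ⟨rfl, hβ⟩ := inr_mem_critFlip.1 hq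
    simpa [supp] using (mem_critY.1 hβ).2

/-- `F ⊆ g_{ba}`: the flip set lies inside the generator (the support of row `(b, a)` of `H_Z`).
[cite: LeverrierTillichZemor2015, §3 eq. (g_ba) (arXiv v1 p0007)] -/
theorem critFlip_subset_genSupport (H : Matrix B A (ZMod 2)) (e : (A × A) ⊕ (B × B) → ZMod 2) (b : B)
    (a : A) (Χa : Finset A) (Χb : Finset B) :
    critFlip H e b a Χa Χb ⊆ genSupport (expanderHZ H) (b, a) := by
  intro q hq
  rw [genSupport, Finset.mem_filter]
  refine ⟨Finset.mem_univ _, ?_⟩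
  rcases q with ⟨α, a'⟩ | ⟨b', β⟩
  · obtain ⟨rfl, hα⟩ := inl_mem_critFlip.1 hq
    have h := (mem_critX.1 hα).1.1
    simpa [expanderHZ, HypergraphProduct.xMatrix_apply_inl] using h
  · obtain ⟨rfl, hβ⟩ := inr_mem_critFlip.1 hq
    have h := (mem_critY.1 hβ).1.1
    simpa [expanderHZ, HypergraphProduct.xMatrix_apply_inr, Matrix.transpose_apply] using h

/-- Under `IsCritical` the flip set is non-empty (`x_a ∪ x_b ≠ ∅`).
[cite: FawziGrospellierLeverrier2018, Def 22 (x_a ∪ x_b ≠ ∅)] -/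
theorem critFlip_nonempty {H : Matrix B A (ZMod 2)} {dA dB : ℕ} {δA δB : ℝ}
    {e : (A × A) ⊕ (B × B) → ZMod 2} {b : B} {a : A} {Χa : Finset A} {Χb : Finset B}
    (hc : IsCritical H dA dB δA δB (supp e) b a Χa Χb) : (critFlip H e b a Χa Χb).Nonempty := by
  rcases hc.nonempty with ⟨α, hα, hE⟩ | ⟨β, hβ, hE⟩
  · refine ⟨Sum.inl (α, a), inl_mem_critFlip.2 ⟨rfl, ?_⟩⟩
    rw [Finset.mem_sdiff, mem_nbrs, Matrix.transpose_apply] at hα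
    exact mem_critX.2 ⟨hα, by simpa [supp] using hE⟩
  · refine ⟨Sum.inr (b, β), inr_mem_critFlip.2 ⟨rfl, ?_⟩⟩
    rw [Finset.mem_sdiff, mem_nbrs] at hβ
    exact mem_critY.2 ⟨hβ, by simpa [supp] using hE⟩

/-- Under `IsCritical` the flip set is a SMALL SET of the small-set-flip decoder (`F ∈ 𝓕`: a non-empty
subset of a generator). [cite: FawziGrospellierLeverrier2018, §2.3 (𝓕 = {F ⊆ x : x ∈ 𝒳}) and Lemma 24] -/
theorem critFlip_mem_smallSets {H : Matrix B A (ZMod 2)} {dA dB : ℕ} {δA δB : ℝ}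
    {e : (A × A) ⊕ (B × B) → ZMod 2} {b : B} {a : A} {Χa : Finset A} {Χb : Finset B}
    (hc : IsCritical H dA dB δA δB (supp e) b a Χa Χb) :
    critFlip H e b a Χa Χb ∈ smallSets (expanderHZ H) := by
  rw [smallSets, Finset.mem_erase]
  refine ⟨(critFlip_nonempty hc).ne_empty, ?_⟩
  exact Finset.mem_biUnion.2 ⟨(b, a), Finset.mem_univ _,
    Finset.mem_powerset.2 (critFlip_subset_genSupport H e b a Χa Χb)⟩


end QuantumExpander

end Literature.InformationTheory.QuantumCodes
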